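import Summits.ResolutionOfSingularities.ResolutionOfSingularities.Theses.WildCones

/-!
# `NarrowRunsDie` (crux stmt-ResolutionOfSingularities-16882, route `WildCones`): the FUEL FAMILY
# `a_k = u₀²u₁ + u₁³u₂ + u₀u₂^k` — its run under the crux calculus (chart `2`, translation `0`)
(negative-side support for crux stmt-ResolutionOfSingularities-16882, refuter crux-disprover seat; this file
does NOT refute the crux)

The route's inlined `let` calculus (`clean bl ord dv tr step run`, VERBATIM bodies at `p = n = 3`,
`κ = 𝔽₃`) is taken as constrained function variables, and the family as a constrained variable
`cf` (`cf k = Pi.single ![2,1,0] 1 + Pi.single ![0,3,1] 1 + Pi.single ![1,0,k] 1`); every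
hypothesis `h*` is discharged by `rfl` at the point of use (`Negative/NoUniformBound.lean`).
Content: `bl 2` / `dv 2 3` on single monomials and additivity, `tr` by `0` is the identity, hence
`step 2 0 (a_k) = a_(k-2)` (`u₀²u₁ ↦ u₀²u₁u₂³/u₂³`, `u₁³u₂ ↦ u₁³u₂⁴/u₂³`, `u₀u₂^k ↦ u₀u₂^(k+1)/u₂³`)
and `run (a_(2N+3)) m = a_(2N+3-2m)` for `m ≤ N + 1`; `MultP` (`k ≥ 2`) and `OrdP` inlined.
-/

noncomputable section

set_option linter.dupNamespace false

namespace Summit.ResolutionOfSingularities.ResolutionOfSingularities.Theorems.NarrowRunsDie.Negative.Family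


variable (clean : ((Fin 3 → ℕ) → ZMod 3) → ((Fin 3 → ℕ) → ZMod 3))
  (hclean : clean = fun c A => @ite (ZMod 3) (∀ j, 3 ∣ A j) (Classical.dec _) 0 (c A))
variable (bl : Fin 3 → ((Fin 3 → ℕ) → ZMod 3) → ((Fin 3 → ℕ) → ZMod 3))
  (hbl : bl = fun i c B => @ite (ZMod 3) (Finset.sum (Finset.univ.erase i) (fun j => B j) ≤ B i)
    (Classical.dec _) (c (Function.update B i (B i - Finset.sum (Finset.univ.erase i) (fun j => B j)))) 0)
variable (ord : ((Fin 3 → ℕ) → ZMod 3) → ℕ)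
  (hord : ord = fun c => sInf {m : ℕ | ∃ A, c A ≠ 0 ∧ m = Finset.sum Finset.univ (fun j => A j)})
variable (dv : Fin 3 → ℕ → ((Fin 3 → ℕ) → ZMod 3) → ((Fin 3 → ℕ) → ZMod 3))
  (hdv : dv = fun i s c B => c (Function.update B i (B i + s)))
variable (tr : Fin 3 → (Fin 3 → ZMod 3) → ℕ → ((Fin 3 → ℕ) → ZMod 3) → ((Fin 3 → ℕ) → ZMod 3))
  (htr : tr = fun i τ s c B => Finset.sum (Fintype.piFinset (fun _ : Fin 3 => Finset.range (B i + s + 1)))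
    (fun D => @ite (ZMod 3) (D i = 0) (Classical.dec _) (c (B + D) * Finset.prod (Finset.univ.erase i)
      (fun j => ((Nat.choose (B j + D j) (B j) : ℕ) : ZMod 3) * τ j ^ (D j))) 0))
variable (step : Fin 3 → (Fin 3 → ZMod 3) → ((Fin 3 → ℕ) → ZMod 3) → ((Fin 3 → ℕ) → ZMod 3))
  (hstep : step = fun i τ c => clean (tr i τ (@ite ℕ (3 ≤ ord (clean c)) (Classical.dec _) 3 0)
    (dv i (@ite ℕ (3 ≤ ord (clean c)) (Classical.dec _) 3 0) (bl i (clean c)))))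
variable (run : ((Fin 3 → ℕ) → ZMod 3) → (ℕ → Fin 3) → (ℕ → Fin 3 → ZMod 3) → ℕ → ((Fin 3 → ℕ) → ZMod 3))
  (hrun : run = fun c₀ i t m => @Nat.rec (fun _ => (Fin 3 → ℕ) → ZMod 3) c₀ (fun m c => step (i m) (t m) c) m)
variable (ser : ((Fin 3 → ℕ) → ZMod 3) → MvPowerSeries (Fin 3) (ZMod 3))
  (hser : ser = fun c => show MvPowerSeries (Fin 3) (ZMod 3) from fun A : Fin 3 →₀ ℕ => clean c ⇑A)
variable (pd : Fin 3 → MvPowerSeries (Fin 3) (ZMod 3) → MvPowerSeries (Fin 3) (ZMod 3))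
  (hpd : pd = fun i f => show MvPowerSeries (Fin 3) (ZMod 3) from
    fun A : Fin 3 →₀ ℕ => ((A i + 1 : ℕ) : ZMod 3) * f (A + Finsupp.single i 1))
variable (jac : ((Fin 3 → ℕ) → ZMod 3) → Ideal (MvPowerSeries (Fin 3) (ZMod 3)))
  (hjac : jac = fun c => Ideal.span (Set.range (fun i => pd i (ser c))))
variable (cone : ((Fin 3 → ℕ) → ZMod 3) → MvPolynomial (Fin 3) (ZMod 3))
  (hcone : cone = fun c => Finset.sum (Fintype.piFinset (fun _ : Fin 3 => Finset.range (3 + 1)))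
    (fun A => @ite (MvPolynomial (Fin 3) (ZMod 3)) (Finset.sum Finset.univ (fun j => A j) = 3) (Classical.dec _)
      (MvPolynomial.monomial (Finsupp.equivFunOnFinite.symm A) (clean c A)) 0))
variable (Linv : ((Fin 3 → ℕ) → ZMod 3) → Set (Fin 3 → ZMod 3))
  (hLinv : Linv = fun c => {w : Fin 3 → ZMod 3 | MvPolynomial.aeval (fun j : Fin 3 =>
    (MvPolynomial.X (some j) : MvPolynomial (Option (Fin 3)) (ZMod 3)) +
      MvPolynomial.C (w j) * MvPolynomial.X none)
      (cone c) = MvPolynomial.rename some (cone c) +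
        MvPolynomial.C (MvPolynomial.eval w (cone c)) * (MvPolynomial.X none) ^ 3})
variable (dL : ((Fin 3 → ℕ) → ZMod 3) → ℕ)
  (hdL : dL = fun c => Module.finrank (ZMod 3) (Submodule.span (ZMod 3) (Linv c)))

/-! ### The family `a_k = u₀²u₁ + u₁³u₂ + u₀u₂^k` (exponents `![2,1,0]`, `![0,3,1]`, `![1,0,k]`,
all coefficients `1`), as a constrained variable `cf` -/

variable (cf : ℕ → (Fin 3 → ℕ) → ZMod 3)
  (hcf : cf = fun k => (Pi.single (![2, 1, 0] : Fin 3 → ℕ) (1 : ZMod 3) : (Fin 3 → ℕ) → ZMod 3) +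
    Pi.single (![0, 3, 1] : Fin 3 → ℕ) (1 : ZMod 3) + Pi.single (![1, 0, k] : Fin 3 → ℕ) (1 : ZMod 3))

/-- Two functions `Fin 3 → ℕ` agree iff they agree at `0, 1, 2`. -/
theorem funext3_iff (X Y : Fin 3 → ℕ) : X = Y ↔ X 0 = Y 0 ∧ X 1 = Y 1 ∧ X 2 = Y 2 := by
  constructor
  · rintro rfl; exact ⟨rfl, rfl, rfl⟩
  · rintro ⟨h0, h1, h2⟩; funext j; fin_cases j <;> assumption

include hcf in
/-- Values of the family state. -/
theorem cf_apply (k : ℕ) (A : Fin 3 → ℕ) : cf k A =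
    (if A = ![2, 1, 0] then 1 else 0) + (if A = ![0, 3, 1] then 1 else 0) +
      (if A = ![1, 0, k] then 1 else 0) := by
  rw [hcf]
  simp only [Pi.add_apply, Pi.single_apply]

include hcf in
/-- Support of the family state: the three exponents. -/
theorem cf_ne_zero_iff (k : ℕ) (A : Fin 3 → ℕ) :
    cf k A ≠ 0 ↔ A = ![2, 1, 0] ∨ A = ![0, 3, 1] ∨ A = ![1, 0, k] := by
  rw [cf_apply cf hcf]
  by_cases h1 : A = ![2, 1, 0]
  · subst h1
    simp
  · by_cases h2 : A = ![0, 3, 1]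
    · subst h2
      simp
    · by_cases h3 : A = ![1, 0, k]
      · subst h3
        simp
      · simp [h1, h2, h3]

include hcf in
/-- Coefficient `1` on each of the three exponents, in the form used below. -/
theorem cf_eq_one_of (k : ℕ) (A : Fin 3 → ℕ) (h : A = ![2, 1, 0] ∨ A = ![0, 3, 1] ∨ A = ![1, 0, k]) :
    cf k A = 1 := by
  rw [cf_apply cf hcf]
  rcases h with rfl | rfl | rfl <;> simp

include hclean hcf in
/-- The family state is cleaned. -/
theorem clean_cf (k : ℕ) : clean (cf k) = cf k := by
  rw [hclean]
  funext A
  beta_reduce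
  by_cases h : ∀ j, 3 ∣ A j
  · rw [if_pos h]
    by_contra hne
    rcases (cf_ne_zero_iff cf hcf k A).1 (Ne.symm hne) with rfl | rfl | rfl
    · exact absurd (h 0) (by decide)
    · exact absurd (h 2) (by decide)
    · exact absurd (h 0) (by simp)
  · rw [if_neg h]

/-- Degree of `![2,1,0]`. -/
theorem sum_v1 : Finset.sum Finset.univ (fun j => (![2, 1, 0] : Fin 3 → ℕ) j) = 3 := by
  simp [Fin.sum_univ_three]

/-- Degree of `![0,3,1]`. -/
theorem sum_v2 : Finset.sum Finset.univ (fun j => (![0, 3, 1] : Fin 3 → ℕ) j) = 4 := by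
  simp [Fin.sum_univ_three]

/-- Degree of `![1,0,k]`. -/
theorem sum_v3 (k : ℕ) : Finset.sum Finset.univ (fun j => (![1, 0, k] : Fin 3 → ℕ) j) = k + 1 := by
  simp [Fin.sum_univ_three]; omega

include hcf in
/-- Every monomial of `a_k` has degree `≥ 3` once `k ≥ 2`. -/
theorem three_le_sum_of_cf_ne_zero (k : ℕ) (hk : 2 ≤ k) (A : Fin 3 → ℕ) (hA : cf k A ≠ 0) :
    3 ≤ Finset.sum Finset.univ (fun j => A j) := by
  rcases (cf_ne_zero_iff cf hcf k A).1 hA with rfl | rfl | rfl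
  · rw [sum_v1]
  · rw [sum_v2]; norm_num
  · rw [sum_v3]; omega

include hord hcf in
/-- The cleaned order of `a_k` is `≥ 3` for `k ≥ 2` (so the step divides by `u₂³`). -/
theorem ord_cf (k : ℕ) (hk : 2 ≤ k) : 3 ≤ ord (cf k) := by
  rw [hord]
  apply le_csInf
  · exact ⟨3, ![2, 1, 0], by rw [cf_eq_one_of cf hcf k _ (Or.inl rfl)]; exact one_ne_zero, sum_v1.symm⟩
  · rintro m ⟨A, hA, rfl⟩
    exact three_le_sum_of_cf_ne_zero cf hcf k hk A hA

/-- `univ.erase 2 = {0, 1}` in `Fin 3`. -/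
theorem erase_two : (Finset.univ.erase (2 : Fin 3)) = {0, 1} := by decide

/-- The off-chart exponent sum in chart `2`. -/
theorem sum_erase_two (B : Fin 3 → ℕ) :
    Finset.sum (Finset.univ.erase (2 : Fin 3)) (fun j => B j) = B 0 + B 1 := by
  rw [erase_two, Finset.sum_pair (by decide)]

include hbl in
/-- `bl 2` is additive. -/
theorem bl_add (f g : (Fin 3 → ℕ) → ZMod 3) : bl 2 (f + g) = bl 2 f + bl 2 g := by
  rw [hbl]; funext B; beta_reduce
  by_cases h : Finset.sum (Finset.univ.erase (2 : Fin 3)) (fun j => B j) ≤ B 2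
  · simp only [if_pos h, Pi.add_apply]
  · simp only [if_neg h, Pi.add_apply, add_zero]

include hdv in
/-- `dv 2 s` is additive. -/
theorem dv_add (s : ℕ) (f g : (Fin 3 → ℕ) → ZMod 3) : dv 2 s (f + g) = dv 2 s f + dv 2 s g := by
  rw [hdv]; funext B; rfl

include hbl in
/-- `bl 2` on a single monomial: `u^A ↦ u₂^{|A|} u₀^{A₀} u₁^{A₁}`. -/
theorem bl_single (A : Fin 3 → ℕ) (v : ZMod 3) :
    bl 2 (Pi.single A v) = Pi.single (Function.update A 2 (A 0 + A 1 + A 2)) v := by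
  rw [hbl]; funext B; beta_reduce
  rw [sum_erase_two]
  by_cases hB : B = Function.update A 2 (A 0 + A 1 + A 2)
  · subst hB
    have h0 : Function.update A 2 (A 0 + A 1 + A 2) 0 = A 0 := Function.update_of_ne (by decide) _ _
    have h1 : Function.update A 2 (A 0 + A 1 + A 2) 1 = A 1 := Function.update_of_ne (by decide) _ _
    rw [h0, h1, Function.update_self, if_pos (by omega), Function.update_idem,
      show A 0 + A 1 + A 2 - (A 0 + A 1) = A 2 from by omega, Function.update_eq_self, Pi.single_eq_same,
      Pi.single_eq_same]
  · rw [Pi.single_eq_of_ne hB]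
    by_cases hc : B 0 + B 1 ≤ B 2
    · rw [if_pos hc]
      apply Pi.single_eq_of_ne
      intro hU
      apply hB
      have e0 : B 0 = A 0 := by
        have := congrFun hU 0; rwa [Function.update_of_ne (by decide)] at this
      have e1 : B 1 = A 1 := by
        have := congrFun hU 1; rwa [Function.update_of_ne (by decide)] at this
      have e2 : B 2 - (B 0 + B 1) = A 2 := by
        have := congrFun hU 2; rwa [Function.update_self] at this
      funext j; fin_cases j
      · simp [e0]
      · simp [e1]
      · simp; omega
    · rw [if_neg hc]

include hdv in
/-- `dv 2 3` on a single monomial with `u₂`-exponent `≥ 3`. -/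
theorem dv_single (B : Fin 3 → ℕ) (hB : 3 ≤ B 2) (v : ZMod 3) :
    dv 2 3 (Pi.single B v) = Pi.single (Function.update B 2 (B 2 - 3)) v := by
  rw [hdv]; funext C; beta_reduce
  by_cases hC : C = Function.update B 2 (B 2 - 3)
  · subst hC
    rw [Function.update_self, Function.update_idem, show B 2 - 3 + 3 = B 2 from by omega,
      Function.update_eq_self, Pi.single_eq_same, Pi.single_eq_same]
  · rw [Pi.single_eq_of_ne hC]
    apply Pi.single_eq_of_ne
    intro hU
    apply hC
    funext j
    by_cases hj : j = 2
    · subst hj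
      have := congrFun hU 2
      rw [Function.update_self] at this
      rw [Function.update_self]; omega
    · have := congrFun hU j
      rw [Function.update_of_ne hj] at this
      rw [Function.update_of_ne hj]; exact this

include htr in
/-- Translation by `0` is the identity on every state (chart `2`). -/
theorem tr_zero_two (c : (Fin 3 → ℕ) → ZMod 3) : tr 2 (fun _ => 0) 3 c = c := by
  rw [htr]; funext B; beta_reduce
  rw [Finset.sum_eq_single (0 : Fin 3 → ℕ)]
  · simp
  · intro D _ hD
    by_cases hD2 : D 2 = 0
    · rw [if_pos hD2]
      have : D 0 ≠ 0 ∨ D 1 ≠ 0 := by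
        by_contra hcon
        push Not at hcon
        apply hD; funext j; fin_cases j <;> simp [hD2, hcon.1, hcon.2]
      rw [erase_two, Finset.prod_pair (by decide)]
      rcases this with h | h <;> simp [h]
    · rw [if_neg hD2]
  · intro h
    exact absurd (Fintype.mem_piFinset.mpr fun _ => by simp) h

include hclean hbl hord hdv htr hstep hcf in
/-- **One step of the family**: `a_k ↦ a_{k-2}` in chart `2` with translation `0` (`k ≥ 2`). -/
theorem step_cf (k : ℕ) (hk : 2 ≤ k) : step 2 (fun _ => 0) (cf k) = cf (k - 2) := by
  rw [hstep]; beta_reduce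
  rw [clean_cf clean hclean cf hcf, if_pos (ord_cf ord hord cf hcf k hk), tr_zero_two tr htr]
  have e1 : Function.update (![2, 1, 0] : Fin 3 → ℕ) 2
      ((![2, 1, 0] : Fin 3 → ℕ) 0 + (![2, 1, 0] : Fin 3 → ℕ) 1 + (![2, 1, 0] : Fin 3 → ℕ) 2) =
        ![2, 1, 3] := by
    funext j; fin_cases j <;> rfl
  have e2 : Function.update (![0, 3, 1] : Fin 3 → ℕ) 2
      ((![0, 3, 1] : Fin 3 → ℕ) 0 + (![0, 3, 1] : Fin 3 → ℕ) 1 + (![0, 3, 1] : Fin 3 → ℕ) 2) =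
        ![0, 3, 4] := by
    funext j; fin_cases j <;> rfl
  have e3 : Function.update (![1, 0, k] : Fin 3 → ℕ) 2
      ((![1, 0, k] : Fin 3 → ℕ) 0 + (![1, 0, k] : Fin 3 → ℕ) 1 + (![1, 0, k] : Fin 3 → ℕ) 2) =
        ![1, 0, k + 1] := by
    funext j; fin_cases j
    · rfl
    · rfl
    · simp; omega
  have d1 : Function.update (![2, 1, 3] : Fin 3 → ℕ) 2 ((![2, 1, 3] : Fin 3 → ℕ) 2 - 3) = ![2, 1, 0] := by
    funext j; fin_cases j <;> rfl
  have d2 : Function.update (![0, 3, 4] : Fin 3 → ℕ) 2 ((![0, 3, 4] : Fin 3 → ℕ) 2 - 3) = ![0, 3, 1] := by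
    funext j; fin_cases j <;> rfl
  have d3 : Function.update (![1, 0, k + 1] : Fin 3 → ℕ) 2 ((![1, 0, k + 1] : Fin 3 → ℕ) 2 - 3) =
      ![1, 0, k - 2] := by
    funext j; fin_cases j
    · rfl
    · rfl
    · simp
  have hdv3 : dv 2 3 (bl 2 (cf k)) = cf (k - 2) := by
    rw [hcf]
    beta_reduce
    rw [bl_add bl hbl, bl_add bl hbl, bl_single bl hbl, bl_single bl hbl, bl_single bl hbl, e1, e2, e3,
      dv_add dv hdv, dv_add dv hdv, dv_single dv hdv _ (by simp), dv_single dv hdv _ (by simp),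
      dv_single dv hdv _ (by simp; omega), d1, d2, d3]
  rw [hdv3, clean_cf clean hclean cf hcf]

include hclean hbl hord hdv htr hstep hrun hcf in
/-- **The run of the family**: from `a_{2N+3}`, stage `m ≤ N + 1` is `a_{2N+3-2m}`. -/
theorem run_cf (N m : ℕ) (hm : m ≤ N + 1) :
    run (cf (2 * N + 3)) (fun _ => 2) (fun _ _ => 0) m = cf (2 * N + 3 - 2 * m) := by
  induction m with
  | zero => rw [hrun]; rfl
  | succ m ih =>
    have h1 : run (cf (2 * N + 3)) (fun _ => 2) (fun _ _ => 0) (m + 1) =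
        step 2 (fun _ => 0) (run (cf (2 * N + 3)) (fun _ => 2) (fun _ _ => 0) m) := by
      rw [hrun]
    rw [h1, ih (by omega), step_cf clean hclean bl hbl ord hord dv hdv tr htr step hstep cf hcf _ (by omega),
      show 2 * N + 3 - 2 * m - 2 = 2 * N + 3 - 2 * (m + 1) from by omega]

/-! ### Narrowness of the family states: `MultP`, `OrdP`, `cone`, `Linv`, `dL` -/

include hclean hcf in
/-- `MultP` at `a_k`, `k ≥ 2` (inlined: cleaned, non-zero, all degrees `≥ 3`). -/
theorem multP_cf (k : ℕ) (hk : 2 ≤ k) : (∃ A, clean (cf k) A ≠ 0) ∧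
    ∀ A, clean (cf k) A ≠ 0 → 3 ≤ Finset.sum Finset.univ (fun j => A j) := by
  rw [clean_cf clean hclean cf hcf]
  exact ⟨⟨![2, 1, 0], by rw [cf_eq_one_of cf hcf k _ (Or.inl rfl)]; exact one_ne_zero⟩,
    three_le_sum_of_cf_ne_zero cf hcf k hk⟩

include hclean hcf in
/-- `OrdP` at `a_k` (inlined: the cleaned monomial `u₀²u₁` has degree exactly `3`). -/
theorem ordP_cf (k : ℕ) : ∃ A, clean (cf k) A ≠ 0 ∧ Finset.sum Finset.univ (fun j => A j) = 3 := by
  rw [clean_cf clean hclean cf hcf]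
  exact ⟨![2, 1, 0], by rw [cf_eq_one_of cf hcf k _ (Or.inl rfl)]; exact one_ne_zero, sum_v1⟩

end Summit.ResolutionOfSingularities.ResolutionOfSingularities.Theorems.NarrowRunsDie.Negative.Family

end
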